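import Summits.QuantumFields.YangMills.Theorems.BalabanLadderIRTwistedSlabHodgeDeterminant
import Summits.QuantumFields.YangMills.Theorems.BalabanLadderIRTwistedSlabRealSlice
import HarnessLib

/-!
# The REAL Coulomb-slice determinant at a twist-eating ladder: `det_ℝ((Δ ⊗ 1_4)|_{ker div}) = (det_ℝ Δ)³` on `𝔰𝔲`-valued fields
# (lit-4's discrete Hodge determinant over the field `ℝ`, instantiated on `suFields` — the real form in which the Laplace constants of K23–K25 live)

HELPER toward stub **T1** `TwistedSlabAnchor` (LINE `twisted-slab-continuity`, crux `IRcof` stmt-QuantumFields-26930, census row 43;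
LEAD prover ym-ir-line-tsc-p1 g4; `--supports` the crux, `--as helper`).  The `ℝ`-linear twin of K8 `…TwistedSlabHodgeDeterminant` (which is `ℂ`-linear on
`tracelessFields`): THE NUMBER (closed form of the T1-tree-exact limit, K24–K25) needs the determinant of K19's `sliceHessian`, an `ℝ`-linear operator modelled on
K13's `realCoulombSlice` — a real form — so the Faddeev–Popov ∕ Feynman-gauge bookkeeping must be available over `ℝ`.  lit-4's
`Literature.Analysis.OperatorTheory.DiscreteHodgeDeterminant.det_restrict_ker_covDiv` is stated over ANY field; this file instantiates it with `K = ℝ`.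
* §1 `suD hU μ`, `suDadj hU μ : suFields →ₗ[ℝ] suFields` — `∇⁺_μ` and `S_μ† − 1` restricted to `𝔰𝔲`-valued fields (K13 `covDeriv_mem_suFields`,
  `covDerivAdj_mem_suFields`); coe lemmas; the commutation hypotheses hDD ∕ hAA ∕ (H) at a phase-flat unitary background (K8's ambient lemmas).
* §2 `sum_hsRe_suLaplacian` (the pairing `Σ_x Re tr((ΔΦ)ᴴΦ) = Σ_μ Σ_x S(∇⁺_μ Φ)`), ★ `suLaplacian_injective_ladder` ∕ `_bijective_ladder` (no zero mode of the
  REAL Faddeev–Popov operator at the twist-eating ladder, K3c `eq_zero_of_covDeriv_ladder_eq_zero`).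
* §3 ★★ `det_realCoulombSlice_ladder` ∕ `_pair`: **`det_ℝ((Δ ⊗ 1_4)|_{ker div}) = (det_ℝ Δ|_{suFields})³`** at the (decorated) twist-eating ladders.
NOT here (honest scope): the identification of K19's `sliceHessian` (in a Frobenius-isometric frame) with `(Δ ⊗ 1)|_{ker div}` transported to
`realCoulombSlice`, the Faddeev–Popov Jacobian `|det D| = √det Δ`, the window-constant bookkeeping and `det Δ` as a product over twisted momenta (THE NUMBER,
next files); anything uniform in `β` (M3) or `L, t` (M4); T1-box 0∕1, T1 proper 0∕1.

HONEST FRAMING: finite-dimensional linear algebra on one box; nothing here bears on `IRcof`, `IR`, or the Yang–Mills mass gap (Clay: NOT proved); R4 =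
`BalabanLadder.UV` only.  References: M. García Pérez, A. González-Arroyo, M. Okawa, JHEP 10 (2017) 150 §2.5; I. Montvay, G. Münster, *Quantum Fields on a
Lattice* §3.3 (3.237)–(3.247).
-/

set_option autoImplicit false

noncomputable section

open scoped Matrix
open Finset
open Literature.MathematicalPhysics.QuantumFieldTheory Literature.MathematicalPhysics.QuantumLattice
open Literature.Analysis.OperatorTheory

namespace Summit.QuantumFields.YangMills.Cruxes.IRcof.TwistedSlab

variable {N : ℕ} {n₀ n₁ n₂ n₃ : ℕ}

/-! ## §1 The covariant differences on `𝔰𝔲`-valued fields, `ℝ`-linearly -/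

section Linear

variable {U : FinTorusSite n₀ n₁ n₂ n₃ × Fin 4 → Matrix (Fin N) (Fin N) ℂ}

/-- **`∇⁺_μ` on `suFields`, `ℝ`-linear** (restriction of K8's `covDerivₗ`). [folklore; GPGAO 2017 §2.3] -/
def suD (hU : ∀ e, U e ∈ Matrix.unitaryGroup (Fin N) ℂ) (μ : Fin 4) : suFields N n₀ n₁ n₂ n₃ →ₗ[ℝ] suFields N n₀ n₁ n₂ n₃ :=
  ((covDerivₗ U μ).restrictScalars ℝ).restrict fun _ hΦ => covDeriv_mem_suFields hU μ hΦ

/-- **`S_μ† − 1` on `suFields`, `ℝ`-linear** (restriction of K8's `covDerivAdjₗ`). [folklore; GPGAO 2017 §2.5] -/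
def suDadj (hU : ∀ e, U e ∈ Matrix.unitaryGroup (Fin N) ℂ) (μ : Fin 4) : suFields N n₀ n₁ n₂ n₃ →ₗ[ℝ] suFields N n₀ n₁ n₂ n₃ :=
  ((covDerivAdjₗ U μ).restrictScalars ℝ).restrict fun _ hΨ => covDerivAdj_mem_suFields hU μ hΨ

/-- Underlying function of `suD`. [folklore] -/
@[simp] theorem coe_suD (hU : ∀ e, U e ∈ Matrix.unitaryGroup (Fin N) ℂ) (μ : Fin 4) (Φ : suFields N n₀ n₁ n₂ n₃) :
    ((suD hU μ Φ : suFields N n₀ n₁ n₂ n₃) : FinTorusSite n₀ n₁ n₂ n₃ → Matrix (Fin N) (Fin N) ℂ) = covDeriv U μ Φ := rfl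

/-- Underlying function of `suDadj`. [folklore] -/
@[simp] theorem coe_suDadj (hU : ∀ e, U e ∈ Matrix.unitaryGroup (Fin N) ℂ) (μ : Fin 4) (Ψ : suFields N n₀ n₁ n₂ n₃) :
    ((suDadj hU μ Ψ : suFields N n₀ n₁ n₂ n₃) : FinTorusSite n₀ n₁ n₂ n₃ → Matrix (Fin N) (Fin N) ℂ) =
      fun x => covShiftAdj U μ Ψ x - (Ψ : FinTorusSite n₀ n₁ n₂ n₃ → Matrix (Fin N) (Fin N) ℂ) x := rfl

variable (hU : ∀ e, U e ∈ Matrix.unitaryGroup (Fin N) ℂ) (hflat : IsPhaseFlat U)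
include hU hflat

/-- hDD for the restricted maps. [folklore] -/
theorem suD_comm (μ ν : Fin 4) (Φ : suFields N n₀ n₁ n₂ n₃) : suD hU μ (suD hU ν Φ) = suD hU ν (suD hU μ Φ) :=
  Subtype.ext (covDeriv_comm hflat μ ν Φ)

/-- hAA for the restricted maps. [folklore] -/
theorem suDadj_comm (μ ν : Fin 4) (Ψ : suFields N n₀ n₁ n₂ n₃) : suDadj hU μ (suDadj hU ν Ψ) = suDadj hU ν (suDadj hU μ Ψ) :=
  Subtype.ext (covDerivAdj_comm hU hflat μ ν Ψ)

/-- (H) for the restricted maps. [folklore] -/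
theorem suD_Dadj_comm (μ ν : Fin 4) (Ψ : suFields N n₀ n₁ n₂ n₃) : suD hU μ (suDadj hU ν Ψ) = suDadj hU ν (suD hU μ Ψ) :=
  Subtype.ext (covDeriv_covDerivAdj_comm hU hflat μ ν Ψ)

end Linear

/-! ## §2 No zero mode of the real Faddeev–Popov operator at the twist-eating ladder -/

section FP

variable {U : FinTorusSite n₀ n₁ n₂ n₃ × Fin 4 → Matrix (Fin N) (Fin N) ℂ}

/-- **The pairing identity** `Σ_x Re tr((ΔΦ)(x)ᴴ Φ(x)) = Σ_μ Σ_x S(∇⁺_μ Φ)(x)` for the real covariant Laplacian on `suFields`. [folklore; GPGAO 2017 §2.5] -/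
theorem sum_hsRe_suLaplacian (hU : ∀ e, U e ∈ Matrix.unitaryGroup (Fin N) ℂ) (Φ : suFields N n₀ n₁ n₂ n₃) :
    ∑ x, (((((DiscreteWeitzenboeck.covLaplacian (suD hU) (suDadj hU) Φ : suFields N n₀ n₁ n₂ n₃) :
        FinTorusSite n₀ n₁ n₂ n₃ → Matrix (Fin N) (Fin N) ℂ) x)ᴴ * (Φ : FinTorusSite n₀ n₁ n₂ n₃ → Matrix (Fin N) (Fin N) ℂ) x).trace).re =
      ∑ μ, ∑ x, (((covDeriv U μ Φ x)ᴴ * covDeriv U μ Φ x).trace).re := by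
  have hpt : ∀ x, (((DiscreteWeitzenboeck.covLaplacian (suD hU) (suDadj hU) Φ : suFields N n₀ n₁ n₂ n₃) :
      FinTorusSite n₀ n₁ n₂ n₃ → Matrix (Fin N) (Fin N) ℂ) x) =
      ∑ μ, (covShiftAdj U μ (covDeriv U μ Φ) x - covDeriv U μ Φ x) := by
    intro x
    rw [DiscreteWeitzenboeck.covLaplacian_apply, Submodule.coe_sum, Finset.sum_apply]
    rfl
  simp only [hpt, Matrix.conjTranspose_sum, Finset.sum_mul, Matrix.trace_sum, Complex.re_sum]
  rw [Finset.sum_comm]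
  exact Finset.sum_congr rfl fun μ _ => sum_hsRe_covDerivAdj hU μ (covDeriv U μ Φ) Φ

/-- A zero mode of the real Faddeev–Popov operator is covariantly constant. [folklore; GPGAO 2017 §2.5] -/
theorem covDeriv_eq_zero_of_suLaplacian_eq_zero (hU : ∀ e, U e ∈ Matrix.unitaryGroup (Fin N) ℂ) (Φ : suFields N n₀ n₁ n₂ n₃)
    (hΦ : DiscreteWeitzenboeck.covLaplacian (suD hU) (suDadj hU) Φ = 0) (μ : Fin 4) (x : FinTorusSite n₀ n₁ n₂ n₃) :
    covDeriv U μ (Φ : FinTorusSite n₀ n₁ n₂ n₃ → Matrix (Fin N) (Fin N) ℂ) x = 0 := by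
  have hsum := sum_hsRe_suLaplacian hU Φ
  have hL : ∀ y, (((DiscreteWeitzenboeck.covLaplacian (suD hU) (suDadj hU) Φ : suFields N n₀ n₁ n₂ n₃) :
      FinTorusSite n₀ n₁ n₂ n₃ → Matrix (Fin N) (Fin N) ℂ) y) = 0 := fun y => by rw [hΦ]; rfl
  simp only [hL, Matrix.conjTranspose_zero, Matrix.zero_mul, Matrix.trace_zero, Complex.zero_re, Finset.sum_const_zero] at hsum
  have hnn : ∀ ν, 0 ≤ ∑ y, (((covDeriv U ν Φ y)ᴴ * covDeriv U ν Φ y).trace).re :=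
    fun ν => Finset.sum_nonneg fun y _ => re_trace_conjTranspose_mul_self_nonneg _
  have hzero := (Finset.sum_eq_zero_iff_of_nonneg fun ν _ => hnn ν).1 hsum.symm
  have hμ := (Finset.sum_eq_zero_iff_of_nonneg fun y _ => re_trace_conjTranspose_mul_self_nonneg (covDeriv U μ Φ y)).1
    (hzero μ (Finset.mem_univ μ)) x (Finset.mem_univ x)
  exact eq_zero_of_hsS_eq_zero hμ

variable [NeZero N] {m : ℕ} {A B : Matrix (Fin N) (Fin N) ℂ} {ω : ℂ}

/-- ★ **No zero mode**: the real Faddeev–Popov operator is INJECTIVE on `suFields` at the twist-eating ladder (`A, B` a unitary Weyl pair, `ω` primitive,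
`N(m+1) ≥ 2`). [cite: GarciaperezGonzalezarroyoOkawa2017, §2.2] -/
theorem suLaplacian_injective_ladder {n₂' n₃' : ℕ} (hAu : A ∈ Matrix.unitaryGroup (Fin N) ℂ) (hBu : B ∈ Matrix.unitaryGroup (Fin N) ℂ)
    (hω : IsPrimitiveRoot ω N) (hAB : A * B = ω • (B * A)) {Γ₂ Γ₃ : Matrix (Fin N) (Fin N) ℂ} (hNm : 2 ≤ N * (m + 1))
    (hU : ∀ e, ladderField (n₀ := m + 1) (n₁ := m + 1) (n₂ := n₂') (n₃ := n₃') ![A, B, Γ₂, Γ₃] e ∈ Matrix.unitaryGroup (Fin N) ℂ) :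
    Function.Injective (DiscreteWeitzenboeck.covLaplacian (suD hU) (suDadj hU)) := by
  refine (injective_iff_map_eq_zero _).2 fun Φ hΦ => ?_
  have hflatΦ := covDeriv_eq_zero_of_suLaplacian_eq_zero hU Φ hΦ
  have htr : ∀ x, ((Φ : FinTorusSite (m + 1) (m + 1) n₂' n₃' → Matrix (Fin N) (Fin N) ℂ) x).trace = 0 := fun x => (Φ.2 x).2
  have h := eq_zero_of_covDeriv_ladder_eq_zero (n₂ := n₂') (n₃ := n₃') hAu hBu hω hAB Γ₂ Γ₃ hNm htr hflatΦ
  exact Subtype.ext h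

/-- ★ The real Faddeev–Popov operator is BIJECTIVE on `suFields` at the twist-eating ladder. [cite: GarciaperezGonzalezarroyoOkawa2017, §2.5] -/
theorem suLaplacian_bijective_ladder {n₂' n₃' : ℕ} (hAu : A ∈ Matrix.unitaryGroup (Fin N) ℂ) (hBu : B ∈ Matrix.unitaryGroup (Fin N) ℂ)
    (hω : IsPrimitiveRoot ω N) (hAB : A * B = ω • (B * A)) {Γ₂ Γ₃ : Matrix (Fin N) (Fin N) ℂ} (hNm : 2 ≤ N * (m + 1))
    (hU : ∀ e, ladderField (n₀ := m + 1) (n₁ := m + 1) (n₂ := n₂') (n₃ := n₃') ![A, B, Γ₂, Γ₃] e ∈ Matrix.unitaryGroup (Fin N) ℂ) :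
    Function.Bijective (DiscreteWeitzenboeck.covLaplacian (suD hU) (suDadj hU)) :=
  ⟨suLaplacian_injective_ladder hAu hBu hω hAB hNm hU, LinearMap.surjective_of_injective (suLaplacian_injective_ladder hAu hBu hω hAB hNm hU)⟩

end FP

/-! ## §3 The real Coulomb-slice determinant at the ladder -/

section Determinant

variable [NeZero N] {m : ℕ} {A B : Matrix (Fin N) (Fin N) ℂ} {ω : ℂ}

/-- ★★ **THE REAL COULOMB-SLICE DETERMINANT AT THE TWIST EATER: `det_ℝ((Δ ⊗ 1_4)|_{ker div}) = (det_ℝ Δ|_{suFields})³`** at a phase-flat unitary ladder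
`![A, B, Γ₂, Γ₃]` (lit-4 `det_restrict_ker_covDiv` over `K = ℝ`, `#ι = 4`). [cite: GarciaperezGonzalezarroyoOkawa2017, §2.5] [cite: MontvayMunster1994, §3.3 (3.237)–(3.247)] -/
theorem det_realCoulombSlice_ladder {n₂' n₃' : ℕ} (hAu : A ∈ Matrix.unitaryGroup (Fin N) ℂ) (hBu : B ∈ Matrix.unitaryGroup (Fin N) ℂ)
    (hω : IsPrimitiveRoot ω N) (hAB : A * B = ω • (B * A)) {Γ₂ Γ₃ : Matrix (Fin N) (Fin N) ℂ} (hNm : 2 ≤ N * (m + 1))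
    (hU : ∀ e, ladderField (n₀ := m + 1) (n₁ := m + 1) (n₂ := n₂') (n₃ := n₃') ![A, B, Γ₂, Γ₃] e ∈ Matrix.unitaryGroup (Fin N) ℂ)
    (hflat : IsPhaseFlat (ladderField (n₀ := m + 1) (n₁ := m + 1) (n₂ := n₂') (n₃ := n₃') ![A, B, Γ₂, Γ₃])) :
    LinearMap.det (M := LinearMap.ker (DiscreteWeitzenboeck.covDiv (suDadj hU)))
        ((DiscreteWeitzenboeck.formLaplacian (suD hU) (suDadj hU)).restrict
          fun _ ha => DiscreteWeitzenboeck.formLaplacian_mem_ker_covDiv (suDadj_comm hU hflat) (suD_Dadj_comm hU hflat) ha) =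
      LinearMap.det (DiscreteWeitzenboeck.covLaplacian (suD hU) (suDadj hU)) ^ 3 := by
  have h := DiscreteWeitzenboeck.det_restrict_ker_covDiv (suD_comm hU hflat) (suD_Dadj_comm hU hflat)
    (suLaplacian_bijective_ladder hAu hBu hω hAB hNm hU)
    fun _ ha => DiscreteWeitzenboeck.formLaplacian_mem_ker_covDiv (suDadj_comm hU hflat) (suD_Dadj_comm hU hflat) ha
  rw [Fintype.card_fin] at h
  exact h

/-- ★★ **The decorated twist-eating ladders `![A, B, c₂·1, c₃·1]`**: the real Coulomb-slice determinant is `(det_ℝ Δ)³`. [cite: GarciaperezGonzalezarroyoOkawa2017, §2.5] -/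
theorem det_realCoulombSlice_ladder_pair {n₂' n₃' : ℕ} (hAu : A ∈ Matrix.unitaryGroup (Fin N) ℂ) (hBu : B ∈ Matrix.unitaryGroup (Fin N) ℂ)
    (hω : IsPrimitiveRoot ω N) (hAB : A * B = ω • (B * A)) {c₂ c₃ : ℂ} (hNm : 2 ≤ N * (m + 1))
    (hU : ∀ e, ladderField (n₀ := m + 1) (n₁ := m + 1) (n₂ := n₂') (n₃ := n₃')
      ![A, B, c₂ • (1 : Matrix (Fin N) (Fin N) ℂ), c₃ • (1 : Matrix (Fin N) (Fin N) ℂ)] e ∈ Matrix.unitaryGroup (Fin N) ℂ) :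
    LinearMap.det (M := LinearMap.ker (DiscreteWeitzenboeck.covDiv (suDadj hU)))
        ((DiscreteWeitzenboeck.formLaplacian (suD hU) (suDadj hU)).restrict
          fun _ ha => DiscreteWeitzenboeck.formLaplacian_mem_ker_covDiv
            (suDadj_comm hU (isPhaseFlat_ladderField_pair (NeZero.ne N) hω.pow_eq_one hAB c₂ c₃))
            (suD_Dadj_comm hU (isPhaseFlat_ladderField_pair (NeZero.ne N) hω.pow_eq_one hAB c₂ c₃)) ha) =
      LinearMap.det (DiscreteWeitzenboeck.covLaplacian (suD hU) (suDadj hU)) ^ 3 :=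
  det_realCoulombSlice_ladder hAu hBu hω hAB hNm hU (isPhaseFlat_ladderField_pair (NeZero.ne N) hω.pow_eq_one hAB c₂ c₃)

end Determinant

end Summit.QuantumFields.YangMills.Cruxes.IRcof.TwistedSlab

end
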